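import Summits.QuantumFields.QCD.Theorems.SpectralDefectExtinctionExtinctionBuildsQCDStubFermiProjectorScreening
import Summits.QuantumFields.QCD.Theses.SpectralDefectExtinction

/-!
# Stub K_AG `stub_signScreeningOfBand` of line `determinant-tilt` (crux `SpectralDefectExtinction.ExtinctionBuildsQCD`,
# item stmt-QuantumFields-18064) — BAND SCREENING ⇒ SIGN SCREENING at the kinematic rate (the Aizenman–Graf step)

For `N_f ∈ {2,3}`, a mass-scaling regularisation `reg`, `c > 0`, a positive mass tuple `m`, the physical branch
`−1 < m_crit(k)` and the mass pin `|m_f(k)| ≤ 1` eventually (`m_f(k) = m_crit(k) + a_k m_f/Z_m(k)`): IF the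
phase-quenched Aizenman–Molchanov fractional moments of the resolvent `(Γ₅ D_W(U, m_f(k), 1) − iη)⁻¹`, `η ∈ (0,1]`,
of the Hermitian Wilson–Dirac operator at the flavour mass are `≤ C (Z_k/a_k)^p e^{−κ w_f(k) ‖x−y‖₁}`
(`w_f(k) = c a_k m_f/Z_k`), THEN the phase-quenched mean of the colour–spin block of the SIGN MATRIX
`sgn(Γ₅ D_W(U, m_f(k), 1)) = cfc Real.sign (Γ₅ D_W)` is `≤ C′ (Z_k/a_k)^{p′} e^{−κ′ w_f(k) ‖x−y‖₁}` with
`C′ = 2C/s + 10368`, `p′ = max p 0`, `κ′ = min κ (1/(800c))`.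

This is the landed weyl-window composition `WeylWindow.stub_fermiProjectorScreening_of_bandScreening` re-run with a
`k`-dependent rate and a polynomial constant: `WeylWindow.stub_aizenmanGrafInMean` (abstract probability measure on
gauge fields; fed the landed deterministic inputs `stub_signKernelResolventBound`, `stub_hermitianWilsonCombesThomas`,
`stub_aizenmanGrafPointwise stub_signKernelResolventBound stub_arctanKernelLocality`) under the phase-quenched
probability measure `qcdLatticeMeasure` (`qcdPhaseQuenchedExpect_eq_integral_qcdLatticeMeasure`,
`isProbabilityMeasure_qcdLatticeMeasure_all`) with `B := C (Z_k/a_k)^p e^{−κ w_f d}` gives `2B/s + 10368 e^{−d/400}`;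
then `a_k ≤ Z_k` eventually (`WeylWindow.eventually_a_le_mul_Zm`, `N_f ≤ 16`) gives `1 ≤ Z_k/a_k`, and
`κ′ w_f(k) ≤ 2c/(800c) = 1/400` because `a_k m_f/Z_k < 2` (pin from above, branch from below).
References (prose): Aizenman–Graf, J. Phys. A 31 (1998) 6783, §2; Aizenman–Warzel, GSM 168, Ch. 13.
-/

noncomputable section

namespace Summit.QuantumFields.QCD.Cruxes.ExtinctionBuildsQCD.DeterminantTilt

open scoped BigOperators Topology Classical MeasureTheory Matrix ENNReal SchwartzMap
open Filter MeasureTheory Matrix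
open Literature.MathematicalPhysics.QuantumLattice Literature.MathematicalPhysics.QuantumFieldTheory
  Literature.Probability.LatticeModels Literature.MathematicalPhysics.AQFT
open Summit.QuantumFields.QCD.Theses.SpectralDefectExtinction
open Summit.QuantumFields.QCD.Cruxes.ExtinctionBuildsQCD.WeylWindow (stub_aizenmanGrafInMean stub_aizenmanGrafPointwise
  stub_signKernelResolventBound stub_arctanKernelLocality stub_hermitianWilsonCombesThomas eventually_a_le_mul_Zm)

-- adapted from Theorems/SpectralDefectExtinctionExtinctionBuildsQCDStubFermiProjectorScreening.lean
-- (`WeylWindow.stub_fermiProjectorScreening_of_bandScreening`, k-dependent rate and polynomial constant)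
/-- **Stub K_AG (`stub_signScreeningOfBand`) — BAND SCREENING ⇒ SIGN SCREENING at the kinematic rate (the
Aizenman–Graf step of the sign module of line `determinant-tilt`).** For `N_f ∈ {2,3}`, a mass-scaling `reg`, `c > 0`,
a positive tuple `m`, the physical branch and the mass pin `|m_f(k)| ≤ 1` eventually: if the phase-quenched fractional
moments of `(Γ₅D_W(U,m_f(k),1) − iη)⁻¹`, `η ∈ (0,1]`, are `≤ C (Z_k/a_k)^p e^{−κ w_f(k)|x−y|₁}`, then the phase-quenched
mean of the colour–spin block of the SIGN MATRIX is `≤ C′ (Z_k/a_k)^{p′} e^{−κ′ w_f(k)|x−y|₁}` with `C′ = 2C/s + 10368`,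
`p′ = max p 0`, `κ′ = min κ (1/(800c))`.  Proof: `WeylWindow.stub_aizenmanGrafInMean` under `qcdLatticeMeasure` with
`B := C (Z_k/a_k)^p e^{−κ w_f d}`, then `1 ≤ Z_k/a_k` eventually and `κ′ w_f(k) ≤ 1/400`. -/
theorem stub_signScreeningOfBand :
    ∀ (Nf : ℕ), Nf = 2 ∨ Nf = 3 → ∀ (reg : QCDRegularisation Nf) (c : ℝ) (m : Fin Nf → ℝ), 0 < c → (∀ f, 0 < m f) →
      reg.HasMassScaling → (∀ᶠ k in atTop, -1 < reg.mcrit k) →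
      (∀ᶠ k in atTop, ∀ f, |reg.mcrit k + reg.a k * m f / reg.Zm k| ≤ 1) →
      (∃ s κ C p : ℝ, 0 < s ∧ s < 1 ∧ 0 < κ ∧ 0 < C ∧ ∀ᶠ k : ℕ in atTop, ∀ S : ℕ, reg.L k ≤ S →
          ∀ η : ℝ, 0 < η → η ≤ 1 → ∀ (f : Fin Nf) (x y : TorusSite 4 (2 * S + 1)),
            qcdPhaseQuenchedExpect (reg.β k) (2 * S + 1) (fun fl => reg.mcrit k + reg.a k * m fl / reg.Zm k)
                (fun U : GaugeConfig 4 (2 * S + 1) SU3 => ∑ p : Fin 3 × Fin 4, ∑ q : Fin 3 × Fin 4,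
                  ‖((spinorLift gammaFive * wilsonDirac (fundamentalRep (Fin 3)) U
                          (reg.mcrit k + reg.a k * m f / reg.Zm k) 1 - ((η : ℂ) * Complex.I) • 1)⁻¹ :
                      Matrix (TorusSite 4 (2 * S + 1) × Fin 3 × Fin 4) (TorusSite 4 (2 * S + 1) × Fin 3 × Fin 4) ℂ)
                    (x, p) (y, q)‖ ^ s) ≤
              C * ((reg.a k)⁻¹ * reg.Zm k) ^ p *
                Real.exp (-(κ * (c * (reg.a k * m f / reg.Zm k)) * (torusTaxiDist x y : ℝ)))) →
        ∃ κ C p : ℝ, 0 < κ ∧ 0 < C ∧ ∀ᶠ k : ℕ in atTop, ∀ S : ℕ, reg.L k ≤ S →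
          ∀ (f : Fin Nf) (x y : TorusSite 4 (2 * S + 1)),
            qcdPhaseQuenchedExpect (reg.β k) (2 * S + 1) (fun fl => reg.mcrit k + reg.a k * m fl / reg.Zm k)
                (fun U : GaugeConfig 4 (2 * S + 1) SU3 => ∑ p : Fin 3 × Fin 4, ∑ q : Fin 3 × Fin 4,
                  ‖(cfc Real.sign (spinorLift gammaFive * wilsonDirac (fundamentalRep (Fin 3)) U
                      (reg.mcrit k + reg.a k * m f / reg.Zm k) 1) :
                    Matrix (TorusSite 4 (2 * S + 1) × Fin 3 × Fin 4) (TorusSite 4 (2 * S + 1) × Fin 3 × Fin 4) ℂ)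
                    (x, p) (y, q)‖) ≤
              C * ((reg.a k)⁻¹ * reg.Zm k) ^ p *
                Real.exp (-(κ * (c * (reg.a k * m f / reg.Zm k)) * (torusTaxiDist x y : ℝ))) := by
  intro Nf hNf reg c m hc hm hMS hbr hpin hBS
  obtain ⟨s, κ, C, r, hs0, hs1, hκ, hC, hk⟩ := hBS
  have hNf16 : Nf ≤ 16 := by rcases hNf with rfl | rfl <;> norm_num
  have hev_a : ∀ᶠ k in atTop, reg.a k ≤ 1 * reg.Zm k := eventually_a_le_mul_Zm hNf16 reg hMS one_pos
  have hc8 : 0 < 1 / (800 * c) := by positivity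
  refine ⟨min κ (1 / (800 * c)), 2 * C / s + 10368, max r 0, lt_min hκ hc8, by positivity, ?_⟩
  filter_upwards [hk, hpin, hev_a, hbr] with k hk hmk hak hbk S hS f x y
  set mq : Fin Nf → ℝ := fun fl => reg.mcrit k + reg.a k * m fl / reg.Zm k with hmq
  have hm₀ : |mq f| ≤ 1 := hmk f
  set d : ℕ := torusTaxiDist x y with hd
  set Q : ℝ := (reg.a k)⁻¹ * reg.Zm k with hQ
  set w : ℝ := c * (reg.a k * m f / reg.Zm k) with hw
  have hprob := isProbabilityMeasure_qcdLatticeMeasure_all (S := 2 * S + 1) (reg.β k) mq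
  rw [qcdPhaseQuenchedExpect_eq_integral_qcdLatticeMeasure]
  -- positivity bookkeeping
  have ha := reg.a_pos k
  have hZ := reg.Zm_pos k
  have hQpos : 0 < Q := mul_pos (inv_pos.2 ha) hZ
  have hQ1 : 1 ≤ Q := (one_le_inv_mul₀ ha).2 (by simpa using hak)
  have ht0 : 0 ≤ reg.a k * m f / reg.Zm k := div_nonneg (mul_nonneg ha.le (hm f).le) hZ.le
  have hw0 : 0 ≤ w := mul_nonneg hc.le ht0
  have hdnn : (0 : ℝ) ≤ d := Nat.cast_nonneg d
  have hQr0 : 0 ≤ Q ^ r := Real.rpow_nonneg hQpos.le r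
  -- the fractional-moment input in both orientations, in `∫ dν` form
  have hB : 0 ≤ C * Q ^ r * Real.exp (-(κ * w * (d : ℝ))) :=
    mul_nonneg (mul_nonneg hC.le hQr0) (Real.exp_pos _).le
  have hFM : ∀ η : ℝ, 0 < η → η ≤ 1 → ∀ x' y' : TorusSite 4 (2 * S + 1),
      (x' = x ∧ y' = y) ∨ (x' = y ∧ y' = x) →
      ∫ U, (∑ p : Fin 3 × Fin 4, ∑ q : Fin 3 × Fin 4,
        ‖((spinorLift gammaFive * wilsonDirac (fundamentalRep (Fin 3)) U (mq f) 1 -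
            ((η : ℂ) * Complex.I) • 1)⁻¹ :
            Matrix (TorusSite 4 (2 * S + 1) × Fin 3 × Fin 4) (TorusSite 4 (2 * S + 1) × Fin 3 × Fin 4) ℂ)
            (x', p) (y', q)‖ ^ s) ∂(qcdLatticeMeasure (2 * S + 1) (reg.β k) mq) ≤
        C * Q ^ r * Real.exp (-(κ * w * (d : ℝ))) := by
    intro η hη0 hη1 x' y' hxy
    have h := hk S hS η hη0 hη1 f x' y'
    rw [qcdPhaseQuenchedExpect_eq_integral_qcdLatticeMeasure] at h
    refine h.trans (le_of_eq ?_)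
    have hdist : torusTaxiDist x' y' = d := by
      rcases hxy with ⟨rfl, rfl⟩ | ⟨rfl, rfl⟩
      · rfl
      · rw [hd, torusTaxiDist_comm]
    rw [hdist]
  refine (stub_aizenmanGrafInMean stub_signKernelResolventBound stub_hermitianWilsonCombesThomas
    (stub_aizenmanGrafPointwise stub_signKernelResolventBound stub_arctanKernelLocality)
    (2 * S + 1) (qcdLatticeMeasure (2 * S + 1) (reg.β k) mq) (mq f) hm₀ x y s _ hs0 hs1 hB hFM).trans ?_
  -- the two rates under `κ' = min κ (1/(800 c))`, the two constants under `Q ^ max r 0`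
  have hκ'1 : min κ (1 / (800 * c)) ≤ κ := min_le_left _ _
  have hκ'2 : min κ (1 / (800 * c)) ≤ 1 / (800 * c) := min_le_right _ _
  have hκ'0 : 0 ≤ min κ (1 / (800 * c)) := (lt_min hκ hc8).le
  have ht2 : reg.a k * m f / reg.Zm k ≤ 2 := by
    have h1 := (abs_le.1 (hmk f)).2
    linarith
  have hκ'w : min κ (1 / (800 * c)) * w ≤ 1 / 400 := by
    calc min κ (1 / (800 * c)) * w ≤ 1 / (800 * c) * w := mul_le_mul_of_nonneg_right hκ'2 hw0
      _ = (reg.a k * m f / reg.Zm k) / 800 := by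
          rw [hw]; field_simp
      _ ≤ 1 / 400 := by linarith
  have hE1 : Real.exp (-(κ * w * (d : ℝ))) ≤ Real.exp (-(min κ (1 / (800 * c)) * w * (d : ℝ))) := by
    rw [Real.exp_le_exp, neg_le_neg_iff]
    exact mul_le_mul_of_nonneg_right (mul_le_mul_of_nonneg_right hκ'1 hw0) hdnn
  have hE2 : Real.exp (-((d : ℝ) / 400)) ≤ Real.exp (-(min κ (1 / (800 * c)) * w * (d : ℝ))) := by
    rw [Real.exp_le_exp, neg_le_neg_iff]
    calc min κ (1 / (800 * c)) * w * (d : ℝ) ≤ 1 / 400 * (d : ℝ) := mul_le_mul_of_nonneg_right hκ'w hdnn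
      _ = (d : ℝ) / 400 := by ring
  have hQr : Q ^ r ≤ Q ^ max r 0 := Real.rpow_le_rpow_of_exponent_le hQ1 (le_max_left _ _)
  have hQ1' : 1 ≤ Q ^ max r 0 := Real.one_le_rpow hQ1 (le_max_right _ _)
  have hT1 : C * Q ^ r * Real.exp (-(κ * w * (d : ℝ))) ≤
      C * Q ^ max r 0 * Real.exp (-(min κ (1 / (800 * c)) * w * (d : ℝ))) :=
    mul_le_mul (mul_le_mul_of_nonneg_left hQr hC.le) hE1 (Real.exp_pos _).le (mul_nonneg hC.le (hQr0.trans hQr))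
  have hT2 : Real.exp (-((d : ℝ) / 400)) ≤ Q ^ max r 0 * Real.exp (-(min κ (1 / (800 * c)) * w * (d : ℝ))) :=
    hE2.trans (le_mul_of_one_le_left (Real.exp_pos _).le hQ1')
  calc 2 * (C * Q ^ r * Real.exp (-(κ * w * (d : ℝ)))) / s + 10368 * Real.exp (-((d : ℝ) / 400))
      ≤ 2 * (C * Q ^ max r 0 * Real.exp (-(min κ (1 / (800 * c)) * w * (d : ℝ)))) / s +
          10368 * (Q ^ max r 0 * Real.exp (-(min κ (1 / (800 * c)) * w * (d : ℝ)))) :=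
        add_le_add (div_le_div_of_nonneg_right (mul_le_mul_of_nonneg_left hT1 (by norm_num)) hs0.le)
          (mul_le_mul_of_nonneg_left hT2 (by norm_num))
    _ = (2 * C / s + 10368) * Q ^ max r 0 * Real.exp (-(min κ (1 / (800 * c)) * w * (d : ℝ))) := by ring

end Summit.QuantumFields.QCD.Cruxes.ExtinctionBuildsQCD.DeterminantTilt

end
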